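import Summits.QuantumFields.BalabanUV.T4Continuum.Support.OutputRateFunctionalTablesFamily

/-!
# OutputRateFunctionalTablesComplex — Road D on the COMPLEX chart: the complex values of Bałaban's terms ride on the real kernel as
# TWO REAL ROWS (Re ∕ Im) of the re-indexed domain `C.Dom × (𝒰 × Fin 2)`; the complex-domain η-rate; the transfer to the row's typed
# target `T4OutputRate.NE5 EA EB` by RESTRICTION to a real section of the chart (no surjectivity); the Re∕Im family model and its END

Cell `pub-balaban`, unit `b2b-balaban-t4-ne5-p1` (row NE5 OWNER, gen 35; owner item «g35-b» = ruling R49 (4), `HOME/CLAIMS.log` l.16073, on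
`b2b-balaban-t4-ne5-formalise-leaf-02` gen 16's Road-D modules `OutputRateFunctionalTables` ∕ `…Family` ∕ `…Pointwise` — R48-F OF RECORD).
Summits-side NEW WORK under the LEAN PLACEMENT RULE (cell modelling + bookkeeping over ABSTRACT carriers; nothing printed is asserted; no
`[cite:]` tag; no `Prop`-valued fact is minted — the two `def`s are DATA: the Re∕Im reading of a complex number and the two-row table).
HONEST FRAMING: rung (B)+1 of the FINITE-VOLUME T⁴ continuum programme — NOT infinite volume, NOT a mass gap, NOT the Clay problem, NOT a
proof of NE5 (NOT PRINTED: the series prints ε-UNIFORM bounds, never η-RATES; GAPS G-t4-U3-1).  HONEST DEPENDENCY (cell, verbatim):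
continuum YM on T⁴ ⇐ BetaPertH ∧ nine spine estimates (0/9 proved); BetaPertH ⇐ (D1) ∧ (D4) ∧ CAP+tail; G-an2-4 gates asym, D1 and NE2/3/4.

WHY (R49 (4), print): [Balaban1988RG2Cluster] Lemma 1 (1.33)–(1.34) p. 9 builds the history potentials `V′_k(Y, U, J, B)` «analytic on
U^c_{k+1}(Y, (1+β)α₀, (1+β)α₁, α₀) × {B : |B| < ε₁g_k^{−1}}» from the earlier terms through the Cauchy formulas (1.23) p. 7 ∕ [Balaban1987RG1]
(3.54) p. 280 (`∮ dσ σ^{−6} ℰ^{(j)}(X, U_j(□₀, exp i(τB+σB)))`): the step READS `ℰ^{(j)}(Y,·)` at COMPLEX configurations, with complex values,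
and [Balaban1987RG1] (1.18) p. 263 bounds `|ℰ^{(j)}(X,𝐔,𝐉)| ≤ E₀e^{−κd_j(X)}` «for all configurations (𝐔,𝐉) ∈ 𝐔^c_j(X,α₀,α₁)».  The kernel
(`T4InputCauchyRateData.StepModel`) has REAL functionals and REAL tables.  On Road D (background adjoined to the domain index,
`OutputRateFunctionalTables.paramCarriers`) the complex values therefore ride as TWO REAL ROWS of the chart `𝒰 × Fin 2` — no kernel twin.

WHAT ([folklore] bookkeeping, NO estimate).
* §1 `reIm i z` (row `0` = `Re z`, row `1` = `Im z`); `re_rot_mul : ((−I)^i · z).re = reIm i z`; `|reIm i z| ≤ ‖z‖`; `‖z − w‖ ≤ √2·max` of the rows.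
* §2 `reImTab ℰ : Functional (paramCarriers C (𝒰 × Fin 2)) PUnit` — the two-row table of a COMPLEX term family `ℰ : (ℕ → ℝ) → 𝒰 → C.Dom → ℂ`
  on a chart `𝒰` (run A's family is supplied ALREADY READ at transported chart points — the pairing is the supplier's);
  `decayBound_reImTab` (L05∕L06 of the rows ⇐ the printed complex-domain bound, SAME constant); `ne5_reImTab_of_complex` ∕
  `complex_of_ne5_reImTab` (the kernel's NE5 of the two-row tables ⟺ the COMPLEX-DOMAIN η-rate, up to `√2` backwards).
* §3 **`ne5_of_ne5_reImTab`** — THE TRANSFER TO THE ROW'S TYPED TARGET with the SAME `C₅` and NO surjectivity: a real SECTION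
  `ι : C.BgB → 𝒰` of the chart on which the two runs' functionals of record ARE the Re-rows (`hB : EB g U X = (ℰB g (ι U) X).re`,
  `hA : EA g (C.transport U) X = (ℰA g (ι U) X).re` — at real configurations Bałaban's terms are real) ⟹ `NE5 EA EB W κ θ C₅` over `C`
  (`OutputRateFunctionalTables.ne5_of_section` at the Re-row of the section).
* §4 the Re∕Im FAMILY MODEL: for family slots `S : FamilySlots C (𝒰 × Fin 2) Op Hist` (leaf-02's part 2, `Out` reading the re-indexed domain)
  whose functional is the ROTATION of Bałaban's ONE functional, `S.Out k o h (X,(u,i)) = (−I)^i · Out₀ k o h X` (`hrot`):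
  `representsB_reIm_of_complex` — `RepresentsB (reImTab ℰB)` from the COMPLEX identity `ℰB g u X = Out₀ k (S.opB g k (u,i)) (S.insB g k t (u,i)) X`
  (both rows at once; [II] (2.13) with (1.33) read on the complex chart); `outputEnvelope_rot_of_pointwise` — W2 of the rotated family model
  from the pointwise envelope of `Out₀` (‖(−I)^i‖ = 1); **`ne5_of_familySlots_reIm`** — END: the kernel's `StepModel.ne5_of_stepModel` over
  `paramCarriers C (𝒰 × Fin 2)` (leaf-02's pointwise-in-the-chart W1∕W3∕W4 transfers BY NAME) ⟹ NE5 of the two-row tables ⟹ (§3) `NE5 EA EB W κ θ C₅`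
  over the ORIGINAL carriers.  Every per-chart-point hypothesis is consumed AT COMPLEX CHART POINTS, uniformly (R49 (4) HONEST RIDER:
  rows NE2∕NE3's rates are then read on the complex chart; Q-NE3-ℂ booked).
WHAT IS NOT HERE.  No instance (the complex chart `χ`, its real section `ι`, the term families and the slots at chart points are the
substrate's D-8 ∕ O-8 objects — Q-S16); no estimate of [II]; nothing about Bałaban's functionals is asserted.  0 sorry; axioms ⊆
{propext, Classical.choice, Quot.sound}.
-/

noncomputable section

open scoped BigOperators ENNReal
open Finset Function Metric Set Complex

namespace Summit.QuantumFields.BalabanUV.T4Continuum.OutputRateFunctionalTablesComplex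

open Literature.MathematicalPhysics.QuantumFieldTheory.Balaban1983to89
open Literature.MathematicalPhysics.QuantumFieldTheory.Balaban1983to89.T4OutputRate
open Literature.MathematicalPhysics.QuantumFieldTheory.Balaban1983to89.T4InputCauchyRateData
open Summit.QuantumFields.BalabanUV.T4Continuum.OutputRateFunctionalTables
open Summit.QuantumFields.BalabanUV.T4Continuum.OutputRateFunctionalTablesFamily

variable {C : Carriers} {𝒰 : Type}

/-! ## §1 The two real rows of a complex number -/

/-- [folklore] DATA: the Re∕Im reading — row `0` is the real part, row `1` the imaginary part. -/
def reIm (i : Fin 2) (z : ℂ) : ℝ := if i = 0 then z.re else z.im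

/-- [folklore] Row `0` is the real part. -/
@[simp] theorem reIm_zero (z : ℂ) : reIm 0 z = z.re := rfl

/-- [folklore] Row `1` is the imaginary part. -/
@[simp] theorem reIm_one (z : ℂ) : reIm 1 z = z.im := rfl

/-- [folklore] The Re∕Im reading is ℝ-linear: differences. -/
theorem reIm_sub (i : Fin 2) (z w : ℂ) : reIm i (z - w) = reIm i z - reIm i w := by
  fin_cases i <;> simp [reIm]

/-- [folklore] **BOTH ROWS FROM ONE FUNCTIONAL**: the real part of `(−I)^i · z` is row `i` of `z` (`Re z` for `i = 0`, `Re (−I·z) = Im z`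
for `i = 1`). -/
theorem re_rot_mul (i : Fin 2) (z : ℂ) : ((-I) ^ (i : ℕ) * z).re = reIm i z := by
  fin_cases i <;> simp [reIm]

/-- [folklore] Each row is bounded by the modulus. -/
theorem abs_reIm_le (i : Fin 2) (z : ℂ) : |reIm i z| ≤ ‖z‖ := by
  fin_cases i
  · exact abs_re_le_norm z
  · exact abs_im_le_norm z

/-- [folklore] The modulus is bounded by `√2` times the larger row. -/
theorem norm_le_sqrt_two_mul_of_reIm {z : ℂ} {A : ℝ} (h : ∀ i, |reIm i z| ≤ A) : ‖z‖ ≤ Real.sqrt 2 * A :=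
  (norm_le_sqrt_two_mul_max z).trans
    (mul_le_mul_of_nonneg_left (max_le (by simpa using h 0) (by simpa using h 1)) (Real.sqrt_nonneg _))

/-- [folklore] Two complex numbers agree iff both rows agree. -/
theorem eq_iff_forall_reIm {z w : ℂ} : z = w ↔ ∀ i, reIm i z = reIm i w :=
  ⟨fun h _ => h ▸ rfl, fun h => Complex.ext (by simpa using h 0) (by simpa using h 1)⟩

/-- [folklore] The rotation factor has modulus one. -/
theorem norm_negI_pow (n : ℕ) : ‖(-I) ^ n‖ = 1 := by
  simp

/-! ## §2 The two-row table of a complex term family on a chart; decay and the complex-domain rate -/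

/-- [folklore] DATA: **THE TWO-ROW TABLE** of a complex term family `ℰ : (ℕ → ℝ) → 𝒰 → C.Dom → ℂ` on the chart `𝒰` — a REAL functional over
the re-indexed carriers `paramCarriers C (𝒰 × Fin 2)`: at `(X, (u, i))` it is row `i` of `ℰ g u X` (the trivial background slot is not read). -/
def reImTab (ℰ : (ℕ → ℝ) → 𝒰 → C.Dom → ℂ) {Bg : Type} : Functional (paramCarriers C (𝒰 × Fin 2)) Bg :=
  fun g _ p => reIm p.2.2 (ℰ g p.2.1 p.1)

/-- [folklore] The two-row table, evaluated. -/
@[simp] theorem reImTab_apply (ℰ : (ℕ → ℝ) → 𝒰 → C.Dom → ℂ) {Bg : Type} (g : ℕ → ℝ) (v : Bg) (p : C.Dom × (𝒰 × Fin 2)) :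
    reImTab (C := C) ℰ g v p = reIm p.2.2 (ℰ g p.2.1 p.1) := rfl

/-- [folklore] **L05∕L06 OF THE ROWS FROM THE PRINTED COMPLEX-DOMAIN BOUND, SAME CONSTANT**: `‖ℰ g u X‖ ≤ E₀·e^{−κd(X)}` at every chart point
([Balaban1987RG1] (1.18) p. 263 on 𝐔^c_j, KIND) gives the kernel's `DecayBound` of the two-row table. -/
theorem decayBound_reImTab {ℰ : (ℕ → ℝ) → 𝒰 → C.Dom → ℂ} {Bg : Type} {W : Set (ℕ → ℝ)} {E₀ κ : ℝ}
    (h : ∀ g ∈ W, ∀ (u : 𝒰) (X : C.Dom), ‖ℰ g u X‖ ≤ E₀ * Real.exp (-(κ * C.d X))) :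
    DecayBound (reImTab (C := C) ℰ (Bg := Bg)) W E₀ κ :=
  fun g hg _ p => (abs_reIm_le _ _).trans (h g hg p.2.1 p.1)

/-- [folklore] **THE KERNEL's NE5 OF THE TWO-ROW TABLES FROM THE COMPLEX-DOMAIN η-RATE** (same constant): if at every chart point and every
domain `‖ℰA g u X − ℰB g u X‖ ≤ C₅·θ^{scale X}·e^{−κd(X)}`, then `NE5 (reImTab ℰA) (reImTab ℰB) W κ θ C₅` over `paramCarriers C (𝒰 × Fin 2)`. -/
theorem ne5_reImTab_of_complex {ℰA ℰB : (ℕ → ℝ) → 𝒰 → C.Dom → ℂ} {W : Set (ℕ → ℝ)} {κ θ C₅ : ℝ}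
    (h : ∀ g ∈ W, ∀ (u : 𝒰) (X : C.Dom), ‖ℰA g u X - ℰB g u X‖ ≤ C₅ * θ ^ C.scale X * Real.exp (-(κ * C.d X))) :
    NE5 (reImTab (C := C) ℰA) (reImTab ℰB) W κ θ C₅ := by
  intro g hg _ p
  rw [paramCarriers_transport, reImTab_apply, reImTab_apply, ← reIm_sub]
  exact (abs_reIm_le _ _).trans (h g hg p.2.1 p.1)

/-- [folklore] … and back: NE5 of the two-row tables gives the complex-domain rate with the constant `√2·C₅`. -/
theorem complex_of_ne5_reImTab {ℰA ℰB : (ℕ → ℝ) → 𝒰 → C.Dom → ℂ} {W : Set (ℕ → ℝ)} {κ θ C₅ : ℝ}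
    (h : NE5 (reImTab (C := C) ℰA) (reImTab ℰB) W κ θ C₅) :
    ∀ g ∈ W, ∀ (u : 𝒰) (X : C.Dom),
      ‖ℰA g u X - ℰB g u X‖ ≤ Real.sqrt 2 * (C₅ * θ ^ C.scale X * Real.exp (-(κ * C.d X))) := by
  intro g hg u X
  refine norm_le_sqrt_two_mul_of_reIm fun i => ?_
  rw [reIm_sub]
  exact h g hg PUnit.unit (X, (u, i))

/-! ## §3 The transfer to the row's typed target along a real section of the chart (no surjectivity) -/

/-- [folklore] **`T4OutputRate.NE5 EA EB` OVER THE ORIGINAL CARRIERS FROM NE5 OF THE TWO-ROW TABLES**, SAME `C₅`: along a SECTION `ι : C.BgB → 𝒰`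
of the chart on which the two runs' functionals of record ARE the Re-rows of the complex families (`hB`, `hA` — at real admissible
configurations Bałaban's terms are real and run A is read at the transported background), NE5 of the two-row tables restricts to the
row's typed target (`ne5_of_section` at the Re-row `(ι U, 0)`).  No surjectivity of any chart map is needed. -/
theorem ne5_of_ne5_reImTab {ℰA ℰB : (ℕ → ℝ) → 𝒰 → C.Dom → ℂ} {EA : Functional C C.BgA} {EB : Functional C C.BgB}
    {W : Set (ℕ → ℝ)} (ι : C.BgB → 𝒰) (hA : ∀ g ∈ W, ∀ (U : C.BgB) (X : C.Dom), EA g (C.transport U) X = (ℰA g (ι U) X).re)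
    (hB : ∀ g ∈ W, ∀ (U : C.BgB) (X : C.Dom), EB g U X = (ℰB g (ι U) X).re) {κ θ C₅ : ℝ}
    (h : NE5 (reImTab (C := C) ℰA) (reImTab ℰB) W κ θ C₅) : NE5 EA EB W κ θ C₅ :=
  ne5_of_section (fun U => (ι U, (0 : Fin 2))) (fun g hg U X => by rw [hA g hg U X]; rfl)
    (fun g hg U X => by rw [hB g hg U X]; rfl) h

/-- [folklore] The same directly from the COMPLEX-DOMAIN η-rate (§2 ∘ §3). -/
theorem ne5_of_complex_rate {ℰA ℰB : (ℕ → ℝ) → 𝒰 → C.Dom → ℂ} {EA : Functional C C.BgA} {EB : Functional C C.BgB}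
    {W : Set (ℕ → ℝ)} (ι : C.BgB → 𝒰) (hA : ∀ g ∈ W, ∀ (U : C.BgB) (X : C.Dom), EA g (C.transport U) X = (ℰA g (ι U) X).re)
    (hB : ∀ g ∈ W, ∀ (U : C.BgB) (X : C.Dom), EB g U X = (ℰB g (ι U) X).re) {κ θ C₅ : ℝ}
    (h : ∀ g ∈ W, ∀ (u : 𝒰) (X : C.Dom), ‖ℰA g u X - ℰB g u X‖ ≤ C₅ * θ ^ C.scale X * Real.exp (-(κ * C.d X))) :
    NE5 EA EB W κ θ C₅ :=
  ne5_of_ne5_reImTab ι hA hB (ne5_reImTab_of_complex h)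

/-! ## §4 The Re∕Im family model: Bałaban's ONE functional rotated on the two rows -/

section Model

variable {Op Hist : Type*} [NormedAddCommGroup Op] [NormedSpace ℂ Op] [NormedAddCommGroup Hist] [NormedSpace ℂ Hist]
variable (S : FamilySlots C (𝒰 × Fin 2) Op Hist) (Out₀ : ℕ → Op → Hist → C.Dom → ℂ)

/-- [folklore] **`RepresentsB` OF THE TWO-ROW TABLE FROM THE COMPLEX IDENTITY** ([II] (2.13) with (1.33) on the complex chart): if the slots'
functional is the ROTATION of Bałaban's one functional `Out₀` on the rows (`hrot`) and, at every chart point `(u, i)`, run B's COMPLEX term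
`ℰB g u X` IS `Out₀` at run B's operator family coordinate and at the coordinate of the insertion of run B's TWO-ROW function table, then the
family model represents the two-row table (both rows at once: `Re ((−I)^i·z) = reIm i z`). -/
theorem representsB_reIm_of_complex {ℰB : (ℕ → ℝ) → 𝒰 → C.Dom → ℂ} {W : Set (ℕ → ℝ)}
    (hrot : ∀ k o h p, S.Out k o h p = (-I) ^ (p.2.2 : ℕ) * Out₀ k o h p.1)
    (h : ∀ g ∈ W, ∀ (X : C.Dom) (u : 𝒰) (i : Fin 2), ℰB g u X =
      Out₀ (C.scale X) (S.opB g (C.scale X) (u, i))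
        (S.insB g (C.scale X) (tableB (reImTab (C := C) ℰB) g PUnit.unit) (u, i)) X) :
    S.toStepModel.RepresentsB (reImTab ℰB) W := by
  intro g hg v p
  show reIm p.2.2 (ℰB g p.2.1 p.1) = (S.Out (C.scale p.1) (S.opB g (C.scale p.1) p.2)
    (S.insB g (C.scale p.1) (tableB (reImTab (C := C) ℰB) g v) p.2) p).re
  rw [hrot, re_rot_mul, ← h g hg p.1 p.2.1 p.2.2]

/-- [folklore] The same for run A (its complex family supplied already read at the transported chart points). -/
theorem representsA_reIm_of_complex {ℰA : (ℕ → ℝ) → 𝒰 → C.Dom → ℂ} {W : Set (ℕ → ℝ)}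
    (hrot : ∀ k o h p, S.Out k o h p = (-I) ^ (p.2.2 : ℕ) * Out₀ k o h p.1)
    (h : ∀ g ∈ W, ∀ (X : C.Dom) (u : 𝒰) (i : Fin 2), ℰA g u X =
      Out₀ (C.scale X) (S.opA g (C.scale X) (u, i))
        (S.insA g (C.scale X) (tableA (reImTab (C := C) ℰA) g PUnit.unit) (u, i)) X) :
    S.toStepModel.RepresentsA (reImTab ℰA) W := by
  intro g hg v p
  show reIm p.2.2 (ℰA g p.2.1 p.1) = (S.Out (C.scale p.1) (S.opA g (C.scale p.1) p.2)
    (S.insA g (C.scale p.1) (tableA (reImTab (C := C) ℰA) g v) p.2) p).re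
  rw [hrot, re_rot_mul, ← h g hg p.1 p.2.1 p.2.2]

/-- [folklore] **W2 OF THE ROTATED FAMILY MODEL FROM THE POINTWISE ENVELOPE OF BAŁABAN's FUNCTIONAL**: complex differentiability and the bound
`G·e^{−κd(X)}` of `z ↦ Out₀ k z.1 z.2 X` on the two-margin box around every coordinate of every admissible family pair transfer to the rotated
functional (`‖(−I)^i‖ = 1`) and hence (leaf-02's `outputEnvelope_of_pointwise`) to the kernel's `OutputEnvelope` of the family model. -/
theorem outputEnvelope_rot_of_pointwise {W : Set (ℕ → ℝ)} {κ G : ℝ}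
    (hrot : ∀ k o h p, S.Out k o h p = (-I) ^ (p.2.2 : ℕ) * Out₀ k o h p.1)
    (h : ∀ k, ∀ g ∈ W, ∀ p ∈ S.Base k g, ∀ (X : C.Dom) (w : 𝒰 × Fin 2), C.scale X = k →
      DifferentiableOn ℂ (fun z : Op × Hist => Out₀ k z.1 z.2 X) (closedBall (p.1 w) (S.rOp k) ×ˢ closedBall (p.2 w) (S.rHist k)) ∧
        ∀ z ∈ closedBall (p.1 w) (S.rOp k) ×ˢ closedBall (p.2 w) (S.rHist k), ‖Out₀ k z.1 z.2 X‖ ≤ G * Real.exp (-(κ * C.d X))) :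
    S.toStepModel.OutputEnvelope W κ G := by
  refine S.outputEnvelope_of_pointwise fun k g hg p hp X w hX => ?_
  obtain ⟨hdiff, hbd⟩ := h k g hg p hp X w hX
  have heq : (fun z : Op × Hist => S.Out k z.1 z.2 (X, w)) = fun z : Op × Hist => (-I) ^ (w.2 : ℕ) * Out₀ k z.1 z.2 X :=
    funext fun z => hrot k z.1 z.2 (X, w)
  refine ⟨?_, fun z hz => ?_⟩
  · rw [heq]
    exact hdiff.const_mul _
  · rw [hrot, norm_mul, norm_negI_pow, one_mul]
    exact hbd z hz

/-- [folklore] **END — `T4OutputRate.NE5 EA EB` OVER THE ORIGINAL CARRIERS FROM THE Re∕Im FAMILY MODEL ON THE COMPLEX CHART.**  Family slots over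
`𝒰 × Fin 2` whose functional is the rotation of Bałaban's one functional; the two runs' COMPLEX term families represented at every chart point
(function tables READ in two rows); run B's family data admissible; the POINTWISE envelope of `Out₀`; the complex-domain decay bounds of the
two families (printed KIND, [I] (1.18)); the POINTWISE operator rate (row NE2's currency AT COMPLEX chart points), insertion rate and
damped-Lipschitz binder; the kernel's smallness — and a real SECTION `ι` of the chart on which the functionals of record are the Re-rows ⟹
`NE5 EA EB W κ θ C₅` with the kernel's constant.  The kernel's END over `paramCarriers C (𝒰 × Fin 2)` + leaf-02's pointwise transfers + §3.
No kernel twin; no surjectivity. -/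
theorem ne5_of_familySlots_reIm [Nonempty 𝒰] {ℰA ℰB : (ℕ → ℝ) → 𝒰 → C.Dom → ℂ} {EA : Functional C C.BgA}
    {EB : Functional C C.BgB} {W : Set (ℕ → ℝ)} {κ G E₀ δ δ' θ c ω : ℝ}
    (hrot : ∀ k o h p, S.Out k o h p = (-I) ^ (p.2.2 : ℕ) * Out₀ k o h p.1)
    (hrA : ∀ g ∈ W, ∀ (X : C.Dom) (u : 𝒰) (i : Fin 2), ℰA g u X =
      Out₀ (C.scale X) (S.opA g (C.scale X) (u, i))
        (S.insA g (C.scale X) (tableA (reImTab (C := C) ℰA) g PUnit.unit) (u, i)) X)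
    (hrB : ∀ g ∈ W, ∀ (X : C.Dom) (u : 𝒰) (i : Fin 2), ℰB g u X =
      Out₀ (C.scale X) (S.opB g (C.scale X) (u, i))
        (S.insB g (C.scale X) (tableB (reImTab (C := C) ℰB) g PUnit.unit) (u, i)) X)
    (hbase : ∀ k, ∀ g ∈ W, (S.opB g k, S.insB g k (tableB (reImTab (C := C) ℰB) g PUnit.unit)) ∈ S.Base k g)
    (henv : ∀ k, ∀ g ∈ W, ∀ p ∈ S.Base k g, ∀ (X : C.Dom) (w : 𝒰 × Fin 2), C.scale X = k →
      DifferentiableOn ℂ (fun z : Op × Hist => Out₀ k z.1 z.2 X) (closedBall (p.1 w) (S.rOp k) ×ˢ closedBall (p.2 w) (S.rHist k)) ∧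
        ∀ z ∈ closedBall (p.1 w) (S.rOp k) ×ˢ closedBall (p.2 w) (S.rHist k), ‖Out₀ k z.1 z.2 X‖ ≤ G * Real.exp (-(κ * C.d X)))
    (hdA : ∀ g ∈ W, ∀ (u : 𝒰) (X : C.Dom), ‖ℰA g u X‖ ≤ G * Real.exp (-(κ * C.d X)))
    (hdB : ∀ g ∈ W, ∀ (u : 𝒰) (X : C.Dom), ‖ℰB g u X‖ ≤ E₀ * Real.exp (-(κ * C.d X))) (hE₀ : E₀ ≤ G)
    (hop : ∀ k, ∀ g ∈ W, ∀ w : 𝒰 × Fin 2, ‖S.opA g k w - S.opB g k w‖ ≤ δ * θ ^ k * S.rOp k)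
    (hins : ∀ k, ∀ g ∈ W, ∀ (t : C.Dom × (𝒰 × Fin 2) → ℝ), (∀ Y w, |t (Y, w)| ≤ E₀ * Real.exp (-(κ * C.d Y))) →
      ∀ w, ‖S.insA g k t w - S.insB g k t w‖ ≤ δ' * θ ^ k * S.rHist k)
    (hdamp : ∀ k, ∀ g ∈ W, ∀ (t t' : C.Dom × (𝒰 × Fin 2) → ℝ) (D : ℕ → ℝ), (∀ j < k, 0 ≤ D j) →
      (∀ Y, C.scale Y < k → ∀ w, |t (Y, w) - t' (Y, w)| ≤ D (C.scale Y) * Real.exp (-(κ * C.d Y))) →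
        ∀ w, ‖S.insA g k t w - S.insA g k t' w‖ ≤ S.rHist k * (c * ∑ j ∈ range k, ω ^ (k - j) * D j))
    (hG : 0 ≤ G) (hδ : 0 ≤ δ + δ') (hc : 0 ≤ c) (hω : 0 ≤ ω) (hsmall : (1 + 4 * G * c) * ω < θ)
    (ι : C.BgB → 𝒰) (hιA : ∀ g ∈ W, ∀ (U : C.BgB) (X : C.Dom), EA g (C.transport U) X = (ℰA g (ι U) X).re)
    (hιB : ∀ g ∈ W, ∀ (U : C.BgB) (X : C.Dom), EB g U X = (ℰB g (ι U) X).re) :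
    NE5 EA EB W κ θ (4 * G * (δ + δ') * (θ - ω) / (θ - (1 + 4 * G * c) * ω)) :=
  ne5_of_ne5_reImTab ι hιA hιB
    (S.toStepModel.ne5_of_stepModel (representsA_reIm_of_complex S Out₀ hrot hrA) (representsB_reIm_of_complex S Out₀ hrot hrB)
      (fun k g hg _ => hbase k g hg) (outputEnvelope_rot_of_pointwise S Out₀ hrot henv) (decayBound_reImTab hdA)
      (decayBound_reImTab hdB) hE₀ ((S.operatorRate_iff_pointwise W δ θ).2 hop) (S.insertionRate_of_pointwise hins)
      (S.insertionDamped_of_pointwise hdamp) hG hδ hc hω hsmall)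

end Model

end Summit.QuantumFields.BalabanUV.T4Continuum.OutputRateFunctionalTablesComplex

end
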